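import Summits.CriticalPhenomena.PercolationContinuityZ3.Theorems.Transplant.FKConnectivityAllQTwoSumMixed
import Summits.CriticalPhenomena.PercolationContinuityZ3.Theorems.Transplant.FKConnectivityAllQSPMono
import Summits.CriticalPhenomena.PercolationContinuityZ3.Theorems.Transplant.FKConnectivityAllQTwoTree
import HarnessLib

/-!
# Connectivity correlation inequalities for `φ_{w,q}`, every `q > 0` — TWO-SUMS, file 3: the two inputs of Wagner's two-sum
# theorem for NEGATIVELY ASSOCIATED parts — (MONO) of a part from its negative association, and the EFFECTIVE EDGE

Support file (`--supports stmt-CriticalPhenomena-4575`), FK sub-lane `prim-bschramm-fk-1` (gen 6) of the post-continuity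
programme; builds on p205010 (kernel theorem, internal audit signed; external expert review pending).  No definitions, no named
facts, no sorries; standard axioms.

Setting as in `…TwoSumMixed.lean`: parts `E₁, E₂` (disjoint edge sets on vertex sets `V₁, V₂`, `V₁ ∩ V₂ ⊆ {s,t}`, `s ≠ t`),
one ambient weight vector `w`, network masses `NMᵢ = FK.netMass w q Eᵢ`, `C = {s ↔ t}`, `J_g = {g open}`, virtual edge `st = s(s,t)`.
* **`FK.spMono_of_edgeNegCorrSupp`** (`0 < q < 1`) — if every weight vector supported in `insert st P` is edge-negatively
  associated (`EdgeNegCorrSupp (insert st P) q`, fk-1 g5), then the part `P` satisfies fk-2's (MONO) at EVERY pair `f` under every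
  ambient `w`: `NM_P(C∩J_fᶜ)·NM_P(Cᶜ∩J_f) ≤ NM_P(C∩J_f)·NM_P(Cᶜ∩J_fᶜ)`.  Route: restrict `w` to `P` (`netMass_eq_sum_rcWeightW_delW`),
  get EC⁺ `φ_{w_P[f↦0]}(s↔t) ≤ φ_{w_P[f↦1]}(s↔t)` from ONE instance of negative correlation of the pairs `st, f` at
  `w_P[st ↦ ½][f ↦ ½]` (fk-2's `edgeConnMono_of_negCorr_at`, which also lifts over a pair `st` already present in `P`), and rewrite
  the four marked masses through the pinned states (`f = st` and `f ∉ P` are trivial).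
* **`FK.twoSum_effective_edge`** (`0 < q`, `st ∉ E₁`) — MARGINALISING A PART IS AN EFFECTIVE EDGE (Wagner's substitution
  `y_g = (1−γ)/(γ−q)`, second case of the proof of Thm. 5.8(d)): with `K₂ = NM₂(C)`, `D₂ = NM₂(Cᶜ)` and the weight vector
  `u = (w|E₁)[st ↦ p*]`, `p* = qK₂/(qK₂ + D₂) ∈ [0,1]`, one has `q^{|V|}·NM_{E₁∪E₂}(A) = (qK₂ + D₂)·S_u(A)` for every event `A`
  read on the first part and insensitive to `st` (one-mark parallel laws + the toggle identity at `st`); `u` is supported in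
  `insert st E₁` and `qK₂ + D₂ > 0`.
* **`FK.negCorr_twoSum_pure`** (`0 < q`) — hence, if `EdgeNegCorrSupp (insert st E₁) q`, then for `w` supported in `E₁ ∪ E₂` and
  pairs `e, f ∈ E₁` (`e` not a loop, `f ≠ e`): `φ_{w,q}(J_e ∩ J_f) ≤ φ_{w,q}(J_e)φ_{w,q}(J_f)` (`φ_w = φ_u` on events of the first part).
[cite: Wagner2006, Lemma 5.5(d), Prop. 5.6, Thm. 5.8(d) (pp. 13–15)] [cite: Grimmett2006, Thm. (3.1)(a) (p. 37); §3.9 eq. (3.94) (pp. 63–64)]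
-/

noncomputable section

namespace Summit.CriticalPhenomena.PercolationContinuityZ3.Theorems

namespace FK

open MeasureTheory SimpleGraph Literature.Probability.LatticeModels Literature.Probability.Percolation
open Literature.Probability.Percolation.BHK2006 (delW)
open Literature.Probability.Percolation.DecisionTree (ind ind_of_mem ind_of_not_mem ind_nonneg)
open scoped Classical symmDiff

variable {V : Type*} [Fintype V]

/-! ### (MONO) of a part from negative association of the part with the virtual edge added -/

/-- With the pair `st` itself as the mark, the "disconnected and marked-open" mass of any part vanishes: an open `st` joins
`s` to `t`. [folklore] -/
theorem netMass_compl_openConn_inter_self (w : Sym2 V → unitInterval) (q : ℝ) (P : Set (Sym2 V)) (s t : V) :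
    netMass w q P ((openConn s t)ᶜ ∩ {η | s(s, t) ∈ η}) = 0 := by
  unfold netMass
  refine Finset.sum_eq_zero fun ω _ => ?_
  have h : ω ∩ P ∉ ((openConn s t)ᶜ ∩ {η : BondConfig V | s(s, t) ∈ η} : Set (BondConfig V)) := by
    rintro ⟨hc, he⟩
    apply hc
    by_cases hst : s = t
    · subst hst; exact (mem_openConn_iff' s s _).2 (Reachable.refl s)
    · exact (mem_openConn_iff' s t _).2 (Adj.reachable ((openGraph_adj _ s t).2 ⟨he, hst⟩))
  rw [ind_of_not_mem h, mul_zero, mul_zero]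

omit [Fintype V] in
/-- Pinning and updating inside `insert st P` keeps the support inside `insert st P`. [folklore] -/
theorem supp_update_update {w : Sym2 V → unitInterval} {S : Set (Sym2 V)} (hw : ∀ e, ((w e : unitInterval) : ℝ) ≠ 0 → e ∈ S)
    {a b : Sym2 V} (ha : a ∈ S) (hb : b ∈ S) (c d : unitInterval) :
    ∀ e, ((Function.update (Function.update w a c) b d e : unitInterval) : ℝ) ≠ 0 → e ∈ S := by
  intro e he
  by_cases heb : e = b
  · exact heb ▸ hb
  · rw [Function.update_of_ne heb] at he
    by_cases hea : e = a
    · exact hea ▸ ha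
    · rw [Function.update_of_ne hea] at he
      exact hw e he

/-- **(MONO) of a negatively associated part** (`0 < q < 1`): if every weight vector supported in `insert st P` is edge-negatively
associated, then for every ambient `w` and every pair `f` the part `P` satisfies fk-2's single-edge monotonicity for the terminals
`s, t`: `NM_P(C∩J_fᶜ)·NM_P(Cᶜ∩J_f) ≤ NM_P(C∩J_f)·NM_P(Cᶜ∩J_fᶜ)` (= EC⁺: opening `f` does not lower `φ_{w|P}(s ↔ t)`; Wagner:
"Rayleigh ⟹ `ΔM{g,f} ≥ 0`"). [cite: Wagner2006, Thm. 5.8(d) (p. 14); §3 (Rayleigh condition)] [cite: Grimmett2006, Thm. (3.1)(a) (p. 37); §3.9 eq. (3.94) (p. 63)] -/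
theorem spMono_of_edgeNegCorrSupp {q : ℝ} (hq0 : 0 < q) (hq1 : q < 1) {P : Set (Sym2 V)} {s t : V} (hst : s ≠ t)
    (hP : EdgeNegCorrSupp (insert s(s, t) P) q) (w : Sym2 V → unitInterval) (f : Sym2 V) :
    netMass w q P (openConn s t ∩ {η | f ∈ η}ᶜ) * netMass w q P ((openConn s t)ᶜ ∩ {η | f ∈ η}) ≤
      netMass w q P (openConn s t ∩ {η | f ∈ η}) * netMass w q P ((openConn s t)ᶜ ∩ {η | f ∈ η}ᶜ) := by
  by_cases hfP : f ∈ P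
  swap
  · exact spMono_of_not_mem w q s t hfP
  by_cases hfst : f = s(s, t)
  · rw [hfst, netMass_compl_openConn_inter_self, mul_zero]
    exact mul_nonneg (netMass_nonneg w hq0.le _ _) (netMass_nonneg w hq0.le _ _)
  -- restrict to the part
  set w₁ : Sym2 V → unitInterval := delW w Pᶜ with hw₁
  have hsupp : ∀ e, ((w₁ e : unitInterval) : ℝ) ≠ 0 → e ∈ P := delW_compl_supported w P
  have hS : ∀ A : Set (BondConfig V), netMass w q P A = ∑ ω : BondConfig V, rcWeightW w₁ q ∅ ω * ind A ω :=
    fun A => netMass_eq_sum_rcWeightW_delW w q P A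
  -- EC⁺ at `f` for the restricted weights, from ONE instance of negative correlation of `st` and `f`
  have half_pos : 0 < ((⟨(1 : ℝ) / 2, by norm_num, by norm_num⟩ : unitInterval) : ℝ) := by norm_num
  have half_lt : ((⟨(1 : ℝ) / 2, by norm_num, by norm_num⟩ : unitInterval) : ℝ) < 1 := by norm_num
  have hEC := edgeConnMono_of_negCorr_at hq0 hq1 w₁ f s t ⟨(1 : ℝ) / 2, by norm_num, by norm_num⟩ half_pos half_lt
    (fun _ hne => hP _ (supp_update_update (S := insert s(s, t) P) (fun e he => Set.mem_insert_of_mem _ (hsupp e he))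
      (Set.mem_insert _ _) (Set.mem_insert_of_mem _ hfP) _ _) s(s, t) f (by rw [Sym2.mk_isDiag_iff]; exact hst) hne)
  rw [real_le_real_iff_mass hq0] at hEC
  -- the four marked masses through the pinned states
  have eC1 : netMass w q P (openConn s t ∩ {η | f ∈ η}) =
      (w₁ f : ℝ) * ∑ ω : BondConfig V, rcWeightW (Function.update w₁ f 1) q ∅ ω * ind (openConn s t) ω := by
    rw [hS, Set.inter_comm (openConn s t) {η | f ∈ η}, sum_rcWeightW_ind_inter_openPair]
  have eC0 : netMass w q P (openConn s t ∩ {η | f ∈ η}ᶜ) =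
      (1 - (w₁ f : ℝ)) * ∑ ω : BondConfig V, rcWeightW (Function.update w₁ f 0) q ∅ ω * ind (openConn s t) ω := by
    rw [hS, sum_rcWeightW_ind_inter_compl w₁ q (openConn s t) {η | f ∈ η}, sum_rcWeightW_ind_affine w₁ q f (openConn s t),
      Set.inter_comm (openConn s t) {η | f ∈ η}, sum_rcWeightW_ind_inter_openPair]
    ring
  have eD1 : netMass w q P ((openConn s t)ᶜ ∩ {η | f ∈ η}) =
      (w₁ f : ℝ) * (rcPartitionFunctionW (Function.update w₁ f 1) q ∅ -
        ∑ ω : BondConfig V, rcWeightW (Function.update w₁ f 1) q ∅ ω * ind (openConn s t) ω) := by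
    rw [hS, Set.inter_comm (openConn s t)ᶜ {η | f ∈ η}, sum_rcWeightW_ind_inter_openPair, sum_rcWeightW_ind_compl]
  have eD0 : netMass w q P ((openConn s t)ᶜ ∩ {η | f ∈ η}ᶜ) =
      (1 - (w₁ f : ℝ)) * (rcPartitionFunctionW (Function.update w₁ f 0) q ∅ -
        ∑ ω : BondConfig V, rcWeightW (Function.update w₁ f 0) q ∅ ω * ind (openConn s t) ω) := by
    rw [hS, sum_rcWeightW_ind_inter_compl w₁ q (openConn s t)ᶜ {η | f ∈ η}, sum_rcWeightW_ind_affine w₁ q f (openConn s t)ᶜ,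
      Set.inter_comm (openConn s t)ᶜ {η | f ∈ η}, sum_rcWeightW_ind_inter_openPair, sum_rcWeightW_ind_compl,
      sum_rcWeightW_ind_compl]
    ring
  rw [eC1, eC0, eD1, eD0]
  have hd0 : 0 ≤ (w₁ f : ℝ) := (w₁ f).2.1
  have hd1 : (w₁ f : ℝ) ≤ 1 := (w₁ f).2.2
  have hcc : 0 ≤ (w₁ f : ℝ) * (1 - (w₁ f : ℝ)) := mul_nonneg hd0 (by linarith)
  nlinarith [mul_le_mul_of_nonneg_left hEC hcc]

/-! ### The effective edge: marginalising the second part -/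

section Effective

variable (w : Sym2 V → unitInterval) {q : ℝ} {E₁ E₂ : Set (Sym2 V)} {V₁ V₂ : Set V}

/-- **The effective edge** (`0 < q`, `st ∉ E₁`): marginalising the second part of a two-sum replaces it by the single pair `st`
with parameter `p* = qK₂/(qK₂ + D₂)`, `K₂ = NM₂(s↔t)`, `D₂ = NM₂(s↮t)`: there are a weight vector `u`, equal to `w` on `E₁`,
supported in `insert st E₁`, and a constant `λ > 0` with `q^{|V|}·NM_{E₁∪E₂}(A) = λ·S_u(A)` for every event `A` read on the first
part and insensitive to `st`.  (Wagner: `(1−q)²ΔN{e,f} = (M^g)²(γ−q)²·ΔL{e,f}(y_g = (1−γ)/(γ−q))`.) [cite: Wagner2006, Lemma 5.5(d), Thm. 5.8(d), proof, second case (pp. 14–15)]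
[cite: Grimmett2006, Thm. (3.1)(a) (p. 37); §3.8 Thm. (3.91) (p. 62)] -/
theorem twoSum_effective_edge (hq0 : 0 < q) (hd : Disjoint E₁ E₂) (h₁ : ∀ e ∈ E₁, ∀ z ∈ e, z ∈ V₁)
    (h₂ : ∀ e ∈ E₂, ∀ z ∈ e, z ∈ V₂) {s t : V} (hS : V₁ ∩ V₂ ⊆ {s, t}) (hst : s ≠ t) (hst₁ : s(s, t) ∉ E₁) :
    ∃ (u : Sym2 V → unitInterval) (c : ℝ), 0 < c ∧ (∀ g ∈ E₁, u g = w g) ∧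
      (∀ g, ((u g : unitInterval) : ℝ) ≠ 0 → g ∈ insert s(s, t) E₁) ∧
      ∀ A : Set (BondConfig V), (∀ η₁ η₂ : Set (Sym2 V), η₁ ⊆ E₁ → η₂ ⊆ E₂ → (η₁ ∪ η₂ ∈ A ↔ η₁ ∈ A)) →
        (∀ ω : BondConfig V, ω ∆ {s(s, t)} ∈ A ↔ ω ∈ A) →
          q ^ Fintype.card V * netMass w q (E₁ ∪ E₂) A = c * ∑ ω : BondConfig V, rcWeightW u q ∅ ω * ind A ω := by
  -- the two masses of the marginalised part
  set K₂ := netMass w q E₂ (openConn s t) with hK₂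
  set D₂ := netMass w q E₂ (openConn s t)ᶜ with hD₂
  have hK₂0 : 0 ≤ K₂ := netMass_nonneg w hq0.le _ _
  have hD₂0 : 0 ≤ D₂ := netMass_nonneg w hq0.le _ _
  have hsum : K₂ + D₂ = netMass w q E₂ Set.univ := by
    rw [netMass_split w q E₂ Set.univ (openConn s t), Set.univ_inter, Set.univ_inter]
  have hpos : 0 < q * K₂ + D₂ := by
    have hZ := netMass_univ_pos w hq0 E₂
    rw [← hsum] at hZ
    rcases le_or_gt q 1 with hq1 | hq1
    · nlinarith [mul_nonneg hq0.le hK₂0]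
    · nlinarith [mul_nonneg hq0.le hK₂0]
  -- the effective parameter
  have hp0 : 0 ≤ q * K₂ / (q * K₂ + D₂) := div_nonneg (mul_nonneg hq0.le hK₂0) hpos.le
  have hp1 : q * K₂ / (q * K₂ + D₂) ≤ 1 := by
    rw [div_le_one hpos]; linarith
  set p : unitInterval := ⟨q * K₂ / (q * K₂ + D₂), hp0, hp1⟩ with hp
  set w₁ : Sym2 V → unitInterval := delW w E₁ᶜ with hw₁
  have hw₁st : w₁ s(s, t) = 0 := delW_compl_of_not_mem w hst₁
  refine ⟨Function.update w₁ s(s, t) p, q * K₂ + D₂, hpos, ?_, ?_, ?_⟩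
  · intro g hg
    have hgst : g ≠ s(s, t) := fun h => hst₁ (h ▸ hg)
    rw [Function.update_of_ne hgst, hw₁, delW_compl_of_mem w hg]
  · intro g hg
    by_cases hgst : g = s(s, t)
    · exact hgst ▸ Set.mem_insert _ _
    · rw [Function.update_of_ne hgst] at hg
      exact Set.mem_insert_of_mem _ (delW_compl_supported w E₁ g hg)
  intro A hA hA'
  -- left side: one-mark parallel laws
  have hL : q ^ Fintype.card V * netMass w q (E₁ ∪ E₂) A =
      netMass w q E₁ (openConn s t ∩ A) * (D₂ + q * K₂) + netMass w q E₁ ((openConn s t)ᶜ ∩ A) * (K₂ + D₂) := by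
    rw [netMass_split w q (E₁ ∪ E₂) A (openConn s t), Set.inter_comm A (openConn s t), Set.inter_comm A (openConn s t)ᶜ,
      mul_add, netMass_parallel_conn w q hd h₁ h₂ hS hst hA, netMass_parallel_disc w q hd h₁ h₂ hS hst hA]
    ring
  -- right side: affine in the parameter of `st`, then the toggle identity at `st`
  have h00 : Function.update w₁ s(s, t) 0 = w₁ := Function.update_eq_self_iff.2 hw₁st.symm
  have h0 : Function.update (Function.update w₁ s(s, t) p) s(s, t) 0 = w₁ := by
    rw [Function.update_idem, h00]
  have h1 : Function.update (Function.update w₁ s(s, t) p) s(s, t) 1 = Function.update w₁ s(s, t) 1 := Function.update_idem _ _ _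
  have haff := sum_rcWeightW_ind_affine (Function.update w₁ s(s, t) p) q s(s, t) A
  rw [Function.update_self, h0, h1] at haff
  have htog := sum_rcWeightW_update_one_eq_toggle w₁ hq0.ne' s t A hA'
  rw [h00] at htog
  have hS₁ : ∀ B : Set (BondConfig V), ∑ ω : BondConfig V, rcWeightW w₁ q ∅ ω * ind B ω = netMass w q E₁ B :=
    fun B => (netMass_eq_sum_rcWeightW_delW w q E₁ B).symm
  rw [hL, haff, htog, hS₁, hS₁, netMass_split w q E₁ A (openConn s t), Set.inter_comm A (openConn s t),
    Set.inter_comm A (openConn s t)ᶜ]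
  have hpval : ((p : unitInterval) : ℝ) = q * K₂ / (q * K₂ + D₂) := rfl
  rw [hpval]
  field_simp
  ring

/-- **Two-sum, pure case** (`0 < q`, `st ∉ E₁`): if every weight vector supported in `insert st E₁` is edge-negatively associated,
then for every `w` supported in `E₁ ∪ E₂` and all pairs `e, f ∈ E₁` (`e` not a loop, `f ≠ e`),
`φ_{w,q}(J_e ∩ J_f) ≤ φ_{w,q}(J_e)·φ_{w,q}(J_f)` — the second part acts on events of the first part as the effective edge `st`.
[cite: Wagner2006, Thm. 5.8(d), proof, second case (pp. 14–15)] [cite: Grimmett2006, §3.9 eq. (3.94) (p. 63)] -/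
theorem negCorr_twoSum_pure (hq0 : 0 < q) (hd : Disjoint E₁ E₂) (h₁ : ∀ e ∈ E₁, ∀ z ∈ e, z ∈ V₁)
    (h₂ : ∀ e ∈ E₂, ∀ z ∈ e, z ∈ V₂) {s t : V} (hS : V₁ ∩ V₂ ⊆ {s, t}) (hst : s ≠ t) (hst₁ : s(s, t) ∉ E₁)
    (hE₁ : EdgeNegCorrSupp (insert s(s, t) E₁) q)
    (hw : ∀ g, ((w g : unitInterval) : ℝ) ≠ 0 → g ∈ E₁ ∪ E₂) {e f : Sym2 V} (he : e ∈ E₁) (hf : f ∈ E₁)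
    (hed : ¬ e.IsDiag) (hfe : f ≠ e) :
    (rcMeasureW w q ∅).real ({ω | e ∈ ω} ∩ {ω | f ∈ ω}) ≤
      (rcMeasureW w q ∅).real {ω | e ∈ ω} * (rcMeasureW w q ∅).real {ω | f ∈ ω} := by
  obtain ⟨u, c, hc, -, hu, hid⟩ := twoSum_effective_edge w hq0 hd h₁ h₂ hS hst hst₁
  have he₂ : e ∉ E₂ := fun h => Set.disjoint_left.1 hd he h
  have hf₂ : f ∉ E₂ := fun h => Set.disjoint_left.1 hd hf h
  have hest : e ≠ s(s, t) := fun h => hst₁ (h ▸ he)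
  have hfst : f ≠ s(s, t) := fun h => hst₁ (h ▸ hf)
  -- the four events are read on the first part and do not depend on `st`
  have locEF : ∀ η₁ η₂ : Set (Sym2 V), η₁ ⊆ E₁ → η₂ ⊆ E₂ →
      (η₁ ∪ η₂ ∈ ({η | e ∈ η} ∩ {η | f ∈ η} : Set (BondConfig V)) ↔ η₁ ∈ ({η | e ∈ η} ∩ {η | f ∈ η} : Set (BondConfig V))) := by
    intro η₁ η₂ g₁ g₂
    rw [Set.mem_inter_iff, Set.mem_inter_iff, markLocal_openPair he₂ η₁ η₂ g₁ g₂, markLocal_openPair hf₂ η₁ η₂ g₁ g₂]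
  have insE : ∀ ω : BondConfig V, ω ∆ {s(s, t)} ∈ ({η | e ∈ η} : Set (BondConfig V)) ↔ ω ∈ ({η | e ∈ η} : Set (BondConfig V)) :=
    fun ω => mem_symmDiff_singleton_of_ne ω hest
  have insF : ∀ ω : BondConfig V, ω ∆ {s(s, t)} ∈ ({η | f ∈ η} : Set (BondConfig V)) ↔ ω ∈ ({η | f ∈ η} : Set (BondConfig V)) :=
    fun ω => mem_symmDiff_singleton_of_ne ω hfst
  have insEF : ∀ ω : BondConfig V, ω ∆ {s(s, t)} ∈ ({η | e ∈ η} ∩ {η | f ∈ η} : Set (BondConfig V)) ↔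
      ω ∈ ({η | e ∈ η} ∩ {η | f ∈ η} : Set (BondConfig V)) := by
    intro ω
    rw [Set.mem_inter_iff, Set.mem_inter_iff, insE ω, insF ω]
  have iEF := hid _ locEF insEF
  have iE := hid _ (markLocal_openPair he₂) insE
  have iF := hid _ (markLocal_openPair hf₂) insF
  have iN := hid Set.univ (markLocal_univ E₁ E₂) (fun ω => by simp)
  -- negative correlation for the effective weight vector, in mass form
  have hNC := (negCorr_real_iff_mass hq0 u e f).1 (hE₁ u hu e f hed hfe)
  have hZu : ∑ ω : BondConfig V, rcWeightW u q ∅ ω * ind (Set.univ : Set (BondConfig V)) ω = rcPartitionFunctionW u q ∅ := by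
    unfold rcPartitionFunctionW
    exact Finset.sum_congr rfl fun ω _ => by rw [ind_of_mem (Set.mem_univ _), mul_one]
  rw [hZu] at iN
  -- transfer to `w`
  rw [negCorr_real_iff_mass hq0]
  have hSw : ∀ A : Set (BondConfig V), ∑ ω : BondConfig V, rcWeightW w q ∅ ω * ind A ω = netMass w q (E₁ ∪ E₂) A :=
    fun A => sum_rcWeightW_ind_eq_netMass w q hw A
  have hZw : rcPartitionFunctionW w q ∅ = netMass w q (E₁ ∪ E₂) Set.univ := by
    rw [← hSw]
    unfold rcPartitionFunctionW
    exact Finset.sum_congr rfl fun ω _ => by rw [ind_of_mem (Set.mem_univ _), mul_one]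
  rw [hSw, hSw, hSw, hZw]
  have hX : 0 < q ^ Fintype.card V := pow_pos hq0 _
  have key : (q ^ Fintype.card V * netMass w q (E₁ ∪ E₂) ({η | e ∈ η} ∩ {η | f ∈ η})) *
      (q ^ Fintype.card V * netMass w q (E₁ ∪ E₂) Set.univ) ≤
      (q ^ Fintype.card V * netMass w q (E₁ ∪ E₂) {η | e ∈ η}) * (q ^ Fintype.card V * netMass w q (E₁ ∪ E₂) {η | f ∈ η}) := by
    rw [iEF, iE, iF, iN]
    nlinarith [mul_le_mul_of_nonneg_left hNC (mul_pos hc hc).le]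
  nlinarith [key, mul_pos hX hX]

end Effective

end FK

end Summit.CriticalPhenomena.PercolationContinuityZ3.Theorems

end
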